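import Summits.CriticalPhenomena.SAWScalingLimit.Theorems.SurfaceUniversality.Negative.LipApproxIndependenceFalseWitness
import Summits.CriticalPhenomena.SAWScalingLimit.Theorems.SAWCompassLatticeSurfaceUniversalityPlusNonVacuity
import Literature.Barriers.CriticalPhenomena.SupercriticalSAWSpaceFillingHyperspace

/-!
# `LipApproxIndependence` is false, III: the refutation

Permanent negative knowledge for the crux `SAWCompassLattice.SurfaceUniversality`
(stmt-CriticalPhenomena-6964), line `registered`. Skeleton v6 of the line rested the crux on the
ALL-RULES approximation-independence statement `LipApproxIndependence`
(`…SurfaceUniversalityApproxDefs`, `@[conjecture]`, stub `stub_lipApproxIndependence`): ANY two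
probe rules and ANY two pinned endpoint approximations of a Dobrushin domain give critical plus path
laws merging on bounded Lipschitz test functions. Worker W4 of lead c2 refuted it on paper
(`Cruxes/SurfaceUniversality/Lines/birth-lipApproxIndependence-refutation.md`): a probe rule with
kind-asymmetric port probes builds ISOLATED BOUNDARY CORRIDORS along flat axis-parallel sides, and a
corridor sealed at a convex corner forces a macroscopic initial segment of the path. This file
kernel-checks the witness (parts I, II: `…FalseAux`, `…FalseWitness`), uniformly in `δ ∈ (0, 1/8]`:

* `tendsto_uA`, `tendsto_vA`, `tendsto_uB`, `tendsto_vB` — the four endpoint drawings converge to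
  the marked points `1`, `2`, `1`, `2`;
* `pathLaw_zero_or_prob`, `ae_pathLaw`, `integral_pathLaw_le`, `pathLaw_eq_dirac` — generic facts on
  `PortGadget.pathLaw` (junk or probability; an atomwise bound bounds the integral; a unique
  admissible path gives a Dirac law);
* `testFn` — `f(c) = min 1 (dist(1 + i, trace c))`, bounded and `1`-Lipschitz;
  `integral_A_le` (`∫ f ≤ 2δ`: every atom passes within `2δ` of the reflex corner `1 + i`),
  `integral_B_eq` (`∫ f = 1`: Dirac mass at the bottom polyline);
* `not_lipApproxIndependence : ¬ LipApproxIndependence`.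

The repaired leaf of the line (`LipSiteFaceApproxIndependence`, skeleton v7: the two honest tight
rules `siteRule`, `faceRule`) is NOT touched: its rules have no kind-asymmetric port probes.
Everything is [folklore] bookkeeping; no SAW estimate is used.
-/

noncomputable section

namespace Summit.CriticalPhenomena.SAWScalingLimit.Theorems.SurfaceUniversality.Negative

open Set Metric
open Literature.Probability.RandomPlanarGeometry
open Literature.Probability.RandomPlanarGeometry.SAW
open Literature.Probability.RandomPlanarGeometry.SAW.YangBaxter

/-! ### Endpoint limits -/

section Limits

open Filter Topology

/-- Distance bound from coordinate bounds. [folklore] -/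
theorem dist_le_of_abs {z w : ℂ} {r s t : ℝ} (h1 : |z.re - w.re| ≤ r) (h2 : |z.im - w.im| ≤ s)
    (h3 : r + s ≤ t) : dist z w ≤ t := by
  rw [Complex.dist_eq]
  refine (Complex.norm_le_abs_re_add_abs_im _).trans ?_
  rw [Complex.sub_re, Complex.sub_im]
  linarith

/-- A family `O(δ)`-close to `P` for `0 < δ ≤ 1/8` tends to `P` along `𝓝[>] 0`. [folklore] -/
theorem tendsto_of_dist_le {g : ℝ → ℂ} {P : ℂ} (C : ℝ)
    (h : ∀ δ, 0 < δ → δ ≤ 1 / 8 → dist (g δ) P ≤ C * δ) : Tendsto g (𝓝[>] 0) (𝓝 P) := by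
  rw [tendsto_iff_dist_tendsto_zero]
  have h1 : ∀ᶠ δ in 𝓝[>] (0 : ℝ), dist (g δ) P ≤ C * δ := by
    filter_upwards [Ioo_mem_nhdsGT (show (0 : ℝ) < 1 / 8 by norm_num)] with δ hδ
      using h δ hδ.1 hδ.2.le
  have h2 : Tendsto (fun δ : ℝ => C * δ) (𝓝[>] 0) (𝓝 0) := by
    have : Tendsto (fun δ : ℝ => C * δ) (𝓝 0) (𝓝 (C * 0)) := tendsto_id.const_mul C
    rw [mul_zero] at this
    exact this.mono_left nhdsWithin_le_nhds
  exact squeeze_zero' (Eventually.of_forall fun _ => dist_nonneg) h1 h2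

/-- `u δ = centre (n, 2) → 1 = pt 0`. [folklore] -/
theorem tendsto_uA : Tendsto (fun δ : ℝ => (δ : ℂ) * PortGadget.embed plusPos (aA δ 0))
    (𝓝[>] (0 : ℝ)) (𝓝 (oct.pt 0)) := by
  rw [oct_pt_zero]
  refine tendsto_of_dist_le 3 fun δ hδ hδ1 => ?_
  obtain ⟨hD1, hD2, -⟩ := nδ_bounds hδ hδ1
  rw [aA, draw_centre]
  refine dist_le_of_abs (r := δ) (s := 2 * δ) ?_ ?_ (by linarith) <;> rw [abs_le] <;> push_cast <;>
    simp only [Complex.one_re, Complex.one_im] <;> constructor <;> linarith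

/-- `v δ = centre (2n - 3, 3) → 2 = pt 1`. [folklore] -/
theorem tendsto_vA : Tendsto (fun δ : ℝ => (δ : ℂ) * PortGadget.embed plusPos (vA δ))
    (𝓝[>] (0 : ℝ)) (𝓝 (oct.pt 1)) := by
  rw [oct_pt_one]
  refine tendsto_of_dist_le 7 fun δ hδ hδ1 => ?_
  obtain ⟨hD1, hD2, hn8⟩ := nδ_bounds hδ hδ1
  have e : ((nδ δ - 3 : ℕ) : ℝ) = (nδ δ : ℝ) - 3 := by
    rw [Nat.cast_sub (by omega)]; norm_num
  rw [vA, draw_centre]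
  refine dist_le_of_abs (r := 4 * δ) (s := 3 * δ) ?_ ?_ (by linarith) <;> rw [abs_le] <;> push_cast <;>
    simp only [Complex.re_ofNat, Complex.im_ofNat, e] <;> constructor <;> linarith

/-- `u' δ = centre (n + 1, 0) → 1 = pt 0`. [folklore] -/
theorem tendsto_uB : Tendsto (fun δ : ℝ => (δ : ℂ) * PortGadget.embed plusPos (aB δ 0))
    (𝓝[>] (0 : ℝ)) (𝓝 (oct.pt 0)) := by
  rw [oct_pt_zero]
  refine tendsto_of_dist_le 2 fun δ hδ hδ1 => ?_
  obtain ⟨hD1, hD2, -⟩ := nδ_bounds hδ hδ1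
  rw [aB, draw_centre]
  refine dist_le_of_abs (r := 2 * δ) (s := 0) ?_ ?_ (by linarith) <;> rw [abs_le] <;> push_cast <;>
    simp only [Complex.one_re, Complex.one_im] <;> constructor <;> linarith

/-- `v' δ = centre (2n - 3, 0) → 2 = pt 1`. [folklore] -/
theorem tendsto_vB : Tendsto (fun δ : ℝ => (δ : ℂ) * PortGadget.embed plusPos (aB δ (nδ δ - 4)))
    (𝓝[>] (0 : ℝ)) (𝓝 (oct.pt 1)) := by
  rw [oct_pt_one]
  refine tendsto_of_dist_le 4 fun δ hδ hδ1 => ?_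
  obtain ⟨hD1, hD2, hn8⟩ := nδ_bounds hδ hδ1
  have e : ((nδ δ - 4 : ℕ) : ℝ) = (nδ δ : ℝ) - 4 := by
    rw [Nat.cast_sub (by omega)]; norm_num
  rw [aB, draw_centre]
  refine dist_le_of_abs (r := 4 * δ) (s := 0) ?_ ?_ (by linarith) <;> rw [abs_le] <;> push_cast <;>
    simp only [Complex.re_ofNat, Complex.im_ofNat, e] <;> constructor <;> linarith

end Limits

/-! ### Path laws: junk or probability, integral bounds, Dirac laws -/

section PathLaw

open MeasureTheory
open scoped ENNReal BoundedContinuousFunction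

variable {V : Type*} {G : SimpleGraph V} {y : V → V → ℝ} {emb : V → ℂ} {S : Set V} {δ : ℝ} {u v : V}

/-- A path law is the junk measure `0` or a probability measure. [folklore] -/
theorem pathLaw_zero_or_prob : PortGadget.pathLaw G y emb S δ u v = 0 ∨
    IsProbabilityMeasure (PortGadget.pathLaw G y emb S δ u v) := by
  unfold PortGadget.pathLaw
  by_cases h0 : PortGadget.pathMeasure G y emb S δ u v Set.univ = 0
  · exact Or.inl (by rw [Measure.measure_univ_eq_zero.1 h0, smul_zero])
  by_cases htop : PortGadget.pathMeasure G y emb S δ u v Set.univ = ⊤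
  · exact Or.inl (by rw [htop, ENNReal.inv_top, zero_smul])
  · exact Or.inr ⟨by rw [Measure.smul_apply, smul_eq_mul, ENNReal.inv_mul_cancel h0 htop]⟩

/-- A measurable property holding at the drawn curve of every admissible path holds almost
everywhere for the path law. [folklore] -/
theorem ae_pathLaw {P : CurveClass ℂ → Prop} (hP : MeasurableSet {x | P x})
    (h : ∀ p : G.Walk u v, p.IsPath → (∀ w ∈ p.support, w ∈ S) →
      P (CurveClass.mk ⟨p.toCurve fun w => (δ : ℂ) * emb w⟩)) :
    ∀ᵐ x ∂(PortGadget.pathLaw G y emb S δ u v), P x := by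
  unfold PortGadget.pathLaw PortGadget.pathMeasure
  refine Measure.ae_smul_measure ?_ _
  rw [Measure.ae_sum_iff' hP]
  intro p
  refine Measure.ae_smul_measure ?_ _
  rw [ae_dirac_iff hP]
  exact h p.1 p.2.1 p.2.2

/-- **Integral bound from a bound on every atom**: if `f ≤ C` (`C ≥ 0`) at the drawn curve of every
admissible path, then `∫ f ≤ C` for the path law (junk or probability). [folklore] -/
theorem integral_pathLaw_le (f : CurveClass ℂ →ᵇ ℝ) {C : ℝ} (hC : 0 ≤ C)
    (h : ∀ p : G.Walk u v, p.IsPath → (∀ w ∈ p.support, w ∈ S) →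
      f (CurveClass.mk ⟨p.toCurve fun w => (δ : ℂ) * emb w⟩) ≤ C) :
    ∫ x, f x ∂(PortGadget.pathLaw G y emb S δ u v) ≤ C := by
  have hae : ∀ᵐ x ∂(PortGadget.pathLaw G y emb S δ u v), f x ≤ C :=
    ae_pathLaw (isClosed_le f.continuous continuous_const).measurableSet h
  rcases pathLaw_zero_or_prob (G := G) (y := y) (emb := emb) (S := S) (δ := δ) (u := u) (v := v)
    with h0 | hprob
  · rw [h0, integral_zero_measure]; exact hC
  · calc ∫ x, f x ∂(PortGadget.pathLaw G y emb S δ u v)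
        ≤ ∫ _, C ∂(PortGadget.pathLaw G y emb S δ u v) :=
          integral_mono_ae (f.integrable _) (integrable_const C) hae
      _ = C := by simp

/-- **A path law with a unique admissible path is the Dirac mass at its drawn curve** (positive
weight). [folklore] -/
theorem pathLaw_eq_dirac (p₀ : G.Walk u v) (hp₀ : p₀.IsPath) (hS₀ : ∀ w ∈ p₀.support, w ∈ S)
    (huniq : ∀ p : G.Walk u v, p.IsPath → (∀ w ∈ p.support, w ∈ S) → p = p₀)
    (hw : 0 < PortGadget.walkWeight y p₀) :
    PortGadget.pathLaw G y emb S δ u v =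
      Measure.dirac (CurveClass.mk ⟨p₀.toCurve fun w => (δ : ℂ) * emb w⟩) := by
  letI : Unique {p : G.Walk u v // p.IsPath ∧ ∀ w ∈ p.support, w ∈ S} :=
    ⟨⟨⟨p₀, hp₀, hS₀⟩⟩, fun p => Subtype.ext (huniq p.1 p.2.1 p.2.2)⟩
  have hsum : PortGadget.pathMeasure G y emb S δ u v = ENNReal.ofReal (PortGadget.walkWeight y p₀) •
      Measure.dirac (CurveClass.mk ⟨p₀.toCurve fun w => (δ : ℂ) * emb w⟩) := by
    unfold PortGadget.pathMeasure
    rw [Measure.sum_fintype, Fintype.sum_unique]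
    rfl
  have h0 : ENNReal.ofReal (PortGadget.walkWeight y p₀) ≠ 0 := by simpa using hw
  rw [PortGadget.pathLaw, hsum, Measure.smul_apply, measure_univ, smul_eq_mul, mul_one, smul_smul,
    ENNReal.inv_mul_cancel h0 ENNReal.ofReal_ne_top, one_smul]

end PathLaw

/-! ### The test function and the two integrals -/

section TestFn

open MeasureTheory Filter Topology
open scoped NNReal ENNReal BoundedContinuousFunction
open Literature.Barriers.CriticalPhenomena.SupercriticalSAW
  (lipschitzWith_infDist_range range_toCurve_subset_of_convex)

/-- The reflex corner `P = 1 + i` of the arch (top of the sealed column). [folklore] -/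
def corner : ℂ := ⟨1, 1⟩

/-- **The test function** `f(c) = min 1 (dist(P, trace c))`: bounded by `1`, `1`-Lipschitz for the
reparametrisation distance. [folklore] -/
def testFn : CurveClass ℂ →ᵇ ℝ :=
  BoundedContinuousFunction.ofNormedAddCommGroup (fun c => min 1 (infDist corner c.range))
    ((lipschitzWith_infDist_range corner).const_min 1).continuous 1 fun c => by
      rw [Real.norm_eq_abs, abs_le]
      exact ⟨by linarith [le_min zero_le_one (infDist_nonneg (x := corner) (s := c.range))],
        min_le_left _ _⟩

/-- The test function, evaluated. [folklore] -/
theorem testFn_apply (c : CurveClass ℂ) : testFn c = min 1 (infDist corner c.range) := rfl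

/-- The test function is `1`-Lipschitz. [folklore] -/
theorem testFn_lipschitz : LipschitzWith 1 testFn := (lipschitzWith_infDist_range corner).const_min 1

variable {δ : ℝ} (hδ : 0 < δ) (hδ1 : δ ≤ 1 / 8)
include hδ hδ1

/-- **Family A integrates to `≤ 2δ`**: every atom passes through `centre (n, n)`, drawn within `2δ`
of the corner `P`, and the law has mass `≤ 1`. [folklore] -/
theorem integral_A_le :
    ∫ x, testFn x ∂(plusPathLaw (probeSupport rule oct.carrier δ) δ (aA δ 0) (vA δ)) ≤ 2 * δ := by
  refine integral_pathLaw_le testFn (by linarith) fun p hp hS => ?_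
  have hz := SimpleGraph.Walk.mem_range_toCurve (fun w => (δ : ℂ) * PortGadget.embed plusPos w) p
    (forcedA hδ hδ1 hp hS)
  rw [testFn_apply]
  refine (min_le_right _ _).trans ((infDist_le_dist_of_mem hz).trans ?_)
  obtain ⟨hD1, hD2, hn8⟩ := nδ_bounds hδ hδ1
  have e : ((nδ δ - 2 : ℕ) : ℝ) = nδ δ - 2 := by rw [Nat.cast_sub (by omega)]; norm_num
  rw [dist_comm, aA, draw_centre]
  refine dist_le_of_abs (r := δ) (s := δ) ?_ ?_ (by linarith) <;> rw [abs_le] <;> push_cast <;>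
    simp only [corner, e] <;> constructor <;> linarith

/-- **Family B integrates to `1`**: its law is the Dirac mass at the bottom polyline (ordinate `0`,
at distance `≥ 1` from `P`). [folklore] -/
theorem integral_B_eq :
    ∫ x, testFn x ∂(plusPathLaw (probeSupport rule oct.carrier δ) δ (aB δ 0) (aB δ (nδ δ - 4))) = 1 := by
  obtain ⟨p₀, hp₀, hS₀⟩ := joinableB hδ hδ1
  rw [plusPathLaw, pathLaw_eq_dirac p₀ hp₀ hS₀ (fun p hp hS => uniqueB hδ hδ1 hp hS hp₀ hS₀)
    (walkWeight_plusFugacity_pos sqrt_criticalFugacity_pos p₀), integral_dirac, testFn_apply]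
  refine min_eq_left ((le_infDist (CurveClass.range_nonempty _)).2 fun z hz => ?_)
  have hsub := range_toCurve_subset_of_convex (fun w => (δ : ℂ) * PortGadget.embed plusPos w)
    ((convex_singleton (0 : ℝ)).linear_preimage Complex.imLm) p₀
    (fun w hw => im_eq_zero_B hδ hδ1 hp₀ hS₀ w hw)
  have hz0 : z.im = 0 := hsub hz
  rw [Complex.dist_eq]
  refine le_trans (le_of_eq ?_) (Complex.abs_im_le_norm _)
  rw [Complex.sub_im, hz0]
  simp [corner]

end TestFn

/-! ### The refutation -/

section Main

open MeasureTheory Filter Topology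
open scoped NNReal

/-- **`LipApproxIndependence` is false.** Witness (uniform in `δ ∈ (0, 1/8]`, `n = ⌈1/δ - 1/2⌉₊`):
domain `oct` = the arch octagon `{0<im<2, -2<re<2} ∖ [-1,1]×[0,1]` marked at `a = 1`, `b = 2`; ONE
rule `ρ = ρ' = rule` (centre probe `{0}`, vertical-port probe `{-3/2}`, horizontal-port probe
`{-2i}`, closed flags: rows `0, 1` lose their vertical links, the column east of the wall `re = 1`
its horizontal links below height `1`); family A `u δ = centre (n, 2) → a`,
`v δ = centre (2n-3, 3) → b`: every self-avoiding plus path from `u δ` through the support climbs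
the sealed column through `centre (n, n)`, within `2δ` of the reflex corner `P = 1 + i`; family B
`u' δ = centre (n+1, 0) → a`, `v' δ = centre (2n-3, 0) → b`: the bottom row is an isolated corridor,
the admissible path is unique, the law is the Dirac mass at the bottom polyline (`im ≡ 0`); test
function `f(c) = min 1 (dist(P, trace c))` (bounded, `1`-Lipschitz): `∫ f d(law A) ≤ 2δ` and
`∫ f d(law B) = 1`, so the difference stays `≤ -1/2` while all six hypotheses hold — a `δ`-uniform
gap. Refutes the v6 stub `stub_lipApproxIndependence` of crux stmt-CriticalPhenomena-6964 (all-rules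
approximation independence); the line's repaired leaf `LipSiteFaceApproxIndependence` (two honest
tight rules) is not touched by this witness (its rules have no kind-asymmetric port probes).
[folklore] -/
theorem not_lipApproxIndependence : ¬ LipApproxIndependence := by
  intro h
  have hev : ∀ {P : ℝ → Prop}, (∀ δ, 0 < δ → δ ≤ 1 / 8 → P δ) → ∀ᶠ δ in 𝓝[>] (0 : ℝ), P δ :=
    fun hP => by
      filter_upwards [Ioo_mem_nhdsGT (show (0 : ℝ) < 1 / 8 by norm_num)] with δ hδ
        using hP δ hδ.1 hδ.2.le
  have key := h oct rule rule (fun δ => aA δ 0) vA (fun δ => aB δ 0) (fun δ => aB δ (nδ δ - 4))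
    (hev fun δ hδ hδ1 => joinableA hδ hδ1) tendsto_uA tendsto_vA
    (hev fun δ hδ hδ1 => joinableB hδ hδ1) tendsto_uB tendsto_vB testFn 1 testFn_lipschitz
  have h1 : ∀ᶠ δ in 𝓝[>] (0 : ℝ),
      (∫ x, testFn x ∂(plusPathLaw (probeSupport rule oct.carrier δ) δ (aA δ 0) (vA δ))) -
        ∫ x, testFn x ∂(plusPathLaw (probeSupport rule oct.carrier δ) δ (aB δ 0) (aB δ (nδ δ - 4)))
          ≤ -(1 / 2) :=
    hev fun δ hδ hδ1 => by rw [integral_B_eq hδ hδ1]; linarith [integral_A_le hδ hδ1]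
  have h2 := (tendsto_order.1 key).1 (-(1 / 2)) (by norm_num)
  obtain ⟨δ, hδa, hδb⟩ := (h1.and h2).exists
  linarith

end Main

end Summit.CriticalPhenomena.SAWScalingLimit.Theorems.SurfaceUniversality.Negative

end
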